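import Summits.HodgeConjecture.HodgeConjecture.Theorems.Ring2AbelianAllAndrePolarTriplesTop
import Mathlib.Tactic.Module
import HarnessLib

/-!
# Ring 2 · sub-cell AbelianAll (ALL ABELIAN VARIETIES), André axis, part XXXVIII-h — THE TRACED TRIPLE SUM:
# `(k+1)(k+2)(k+3) · Σ_{a,c,e} τ(x ∪ y_a y_c y_e θᵏ) · b_a b_c b_e = 6(k+3) · θ ∪ ((k+2) Σ_a τ(x ∪ y_a θ^{k+1}) · b_a) − 6 τ(θ^{k+3}) · x`
# on `H³(A(ℂ); ℚ)`, `k + 3 = dim A` — the rational heart of the Kleiman identity of the block `b = 2` (`[ℓ(θ)³]_* ∘ L^{g-3}` on `H³(A)`)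

HONEST FRAMING (page 1, verbatim): **research route, not a corollary; conditional on HC_CM plus one named
minimal statement.** Cell line: research route conditional on HC_CM; not a corollary; Q11.4-sentence-2
already refuted in dim ≥ 3. Nothing in this file proves a case of the Hodge conjecture; `HC_CM` does not occur.

Gen-30 file of the `ab-andre-2` seat (cell `pub-hodge-ring2`, sub-cell AbelianAll = ALL abelian varieties, not Weil-type-only).

## What this file proves (sorry-free, standard axioms only; RATIONAL Betti carriers, COR-CM model layer)

For `A : AbelianVariety ℂ` with `k + 3 = dim A`, a basis `b` of `H¹(A(ℂ); ℚ)`, `θ` and its polar family `y` along `b`: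
* respelled level-`(k+1)` forms of parts XXXVIII-e₁/g (`smul_cup_cup_polar_polar_cupPow'`, `smul_cup_cup_cup_polar_cupPow'`);
* the four index sums `Σ_{a,c,e} b^*_e(·) b^*_c(·) b^*_a(·) · b_a ∪ (b_c ∪ b_e)` against the polar family (Euler identity `Σ_a b_a y_a = 2θ`);
* their two combinations `sum3_thetaPart` (`= 6 · θ ∪ z`) and `sum3_detPart` (the alternating sum, `= 6 · u ∪ (v ∪ w)`);
* **`sum3_smul_cup_eq`** — for every linear functional `τ` on the top degree and every `x ∈ H³(A(ℂ); ℚ)`: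
  `(k+1)(k+2)(k+3) · Σ_a Σ_c Σ_e τ(x ∪ (y_a ∪ (y_c ∪ (y_e ∪ θᵏ)))) · b_a ∪ (b_c ∪ b_e)
     = (6(k+3)) · θ ∪ ((k+2) · Σ_a τ(x ∪ (y_a ∪ θ^{k+1})) · b_a) − (6 τ(θ^{k+3})) · x`.
  In representation-theoretic terms `End_{Sp}(⋀³H¹) = ⟨id, L ∘ Λ⟩` and this is the explicit decomposition of `[ℓ(θ)³]_* ∘ L^{g-3}`; the
  inner sum is `(1/(k+2))(P_{vw} u − P_{uw} v + P_{uv} w)` on `x = u v w`, `P_{uv} = τ(u v θ^{g-1})` (part XXXVIII-g's first formula).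
The complexification / Kleiman identity of the block `b = 2` and the abelian-FOURFOLD pencil assembly are owed (o123, next file).

## Documentary interface

PRINT: Kleiman, Dix exposés, App. to §2, 2A8–2A11; [MumfordAV1970, §1 (4), §16]; Beauville, LNM 1016 (1983), §3. LEAN: displayed theorems,
definition-free, fact-free.
-/

noncomputable section

set_option linter.dupNamespace false

namespace Summit.HodgeConjecture.HodgeConjecture.Ring2.AbelianAll

open CategoryTheory MonoidalCategory CartesianMonoidalCategory
open Literature.AlgebraicTopology.SingularHomology
open Literature.AlgebraicTopology.CharacteristicClasses (cupPow cupPow_zero cupPow_succ)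
open Literature.AlgebraicGeometry.Motives (SchemeOver ComplexPoints IsSmoothProjective bettiCohomology AbelianVariety)
open Literature.AlgebraicGeometry.HodgeTheory
open Summit.HodgeConjecture.CorCM.Model
open scoped MonObj

variable (A : AbelianVariety ℂ)

section Respelled

variable {n k : ℕ} (hk : k + 3 = A.dim) (b : Module.Basis (Fin n) ℚ (bettiCohomology A.X 1))
  {θ : bettiCohomology A.X 2} {y : Fin n → bettiCohomology A.X 1}
  (hℓ : BettiUniverse.pull μ[A.X] 2 θ - BettiUniverse.pull (fst A.X A.X) 2 θ - BettiUniverse.pull (snd A.X A.X) 2 θ =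
    ∑ a, BettiUniverse.cup (A.X ⊗ A.X) 1 1 (BettiUniverse.pull (fst A.X A.X) 1 (b a))
      (BettiUniverse.pull (snd A.X A.X) 1 (y a)))
include hk hℓ

/-- Part XXXVIII-e₁'s two-pair matching formula at level `k + 1`, in the degree spelling of the triple products and cleared of the
denominator `k + 3`. [cite: MumfordAV1970, §16] -/
theorem smul_cup_cup_polar_polar_cupPow' (a c : Fin n) (u w : bettiCohomology A.X 1) :
    (((k + 3 : ℕ) : ℚ) * ((k + 2 : ℕ) : ℚ)) • cupProduct (Nat.add_comm 1 (2 * k + 1 + 1 + 1 + 1 + 1)) u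
        (cupProduct (Nat.add_comm 1 (2 * k + 1 + 1 + 1 + 1)) w
          (cupProduct (Nat.add_comm 1 (2 * k + 1 + 1 + 1)) (y a)
            (cupProduct (Nat.add_comm 1 (2 * k + 1 + 1)) (y c) (cupPow ℚ θ (k + 1))))) =
      (((k + 3 : ℕ) : ℚ) * b.coord c (y a)) • cupProduct (Nat.add_comm 1 (2 * k + 1 + 1 + 1 + 1 + 1)) u
          (cupProduct (Nat.add_comm 1 (2 * k + 1 + 1 + 1 + 1)) w (cupPow ℚ θ (k + 2))) -
        (b.coord c w * b.coord a u - b.coord a w * b.coord c u) • cupPow ℚ θ (k + 3) := by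
  have hk3 : ((k + 3 : ℕ) : ℚ) ≠ 0 := by exact_mod_cast Nat.succ_ne_zero (k + 2)
  have h : ((k + 2 : ℕ) : ℚ) • cupProduct (Nat.add_comm 1 (2 * k + 1 + 1 + 1 + 1 + 1)) u
        (cupProduct (Nat.add_comm 1 (2 * k + 1 + 1 + 1 + 1)) w
          (cupProduct (Nat.add_comm 1 (2 * k + 1 + 1 + 1)) (y a)
            (cupProduct (Nat.add_comm 1 (2 * k + 1 + 1)) (y c) (cupPow ℚ θ (k + 1))))) =
      b.coord c (y a) • cupProduct (Nat.add_comm 1 (2 * k + 1 + 1 + 1 + 1 + 1)) u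
          (cupProduct (Nat.add_comm 1 (2 * k + 1 + 1 + 1 + 1)) w (cupPow ℚ θ (k + 2))) -
        (((k + 3 : ℕ) : ℚ)⁻¹ * (b.coord c w * b.coord a u - b.coord a w * b.coord c u)) • cupPow ℚ θ (k + 3) :=
    smul_cup_cup_polar_polar_cupPow A (k := k + 1) (by omega) b hℓ a c u w
  rw [mul_smul, h, smul_sub, smul_smul, smul_smul, ← mul_assoc, mul_inv_cancel₀ hk3, one_mul]

/-- Part XXXVIII-g's three-plain-one-polar formula at level `k + 1`, in the degree spelling of the triple products. [cite: MumfordAV1970, §16] -/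
theorem smul_cup_cup_cup_polar_cupPow' (a : Fin n) (u v w : bettiCohomology A.X 1) :
    ((k + 2 : ℕ) : ℚ) • cupProduct (Nat.add_comm 1 (2 * k + 1 + 1 + 1 + 1 + 1)) u
        (cupProduct (Nat.add_comm 1 (2 * k + 1 + 1 + 1 + 1)) v
          (cupProduct (Nat.add_comm 1 (2 * k + 1 + 1 + 1)) w
            (cupProduct (Nat.add_comm 1 (2 * k + 1 + 1)) (y a) (cupPow ℚ θ (k + 1))))) =
      b.coord a w • cupProduct (Nat.add_comm 1 (2 * k + 1 + 1 + 1 + 1 + 1)) u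
          (cupProduct (Nat.add_comm 1 (2 * k + 1 + 1 + 1 + 1)) v (cupPow ℚ θ (k + 2))) -
        b.coord a v • cupProduct (Nat.add_comm 1 (2 * k + 1 + 1 + 1 + 1 + 1)) u
          (cupProduct (Nat.add_comm 1 (2 * k + 1 + 1 + 1 + 1)) w (cupPow ℚ θ (k + 2))) +
        b.coord a u • cupProduct (Nat.add_comm 1 (2 * k + 1 + 1 + 1 + 1 + 1)) v
          (cupProduct (Nat.add_comm 1 (2 * k + 1 + 1 + 1 + 1)) w (cupPow ℚ θ (k + 2))) :=
  smul_cup_cup_cup_polar_cupPow A (k := k + 1) (by omega) b hℓ a u v w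

end Respelled

/-! ## Index sums against the polar family -/

section Sums

variable {n : ℕ} (b : Module.Basis (Fin n) ℚ (bettiCohomology A.X 1)) {θ : bettiCohomology A.X 2} {y : Fin n → bettiCohomology A.X 1}
  (hℓ : BettiUniverse.pull μ[A.X] 2 θ - BettiUniverse.pull (fst A.X A.X) 2 θ - BettiUniverse.pull (snd A.X A.X) 2 θ =
    ∑ a, BettiUniverse.cup (A.X ⊗ A.X) 1 1 (BettiUniverse.pull (fst A.X A.X) 1 (b a))
      (BettiUniverse.pull (snd A.X A.X) 1 (y a)))
include hℓ

/-- `Σ_{a,c,e} b^*_e(y_c) b^*_a(z) · b_a ∪ (b_c ∪ b_e) = z ∪ 2θ`. [cite: MumfordAV1970, §16] -/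
theorem sum3_coord_polar_ec (z : bettiCohomology A.X 1) :
    ∑ a, ∑ c, ∑ e, (b.coord e (y c) * b.coord a z) • cupProduct (show 1 + (1 + 1) = 3 by rfl) (b a) (BettiUniverse.cup A.X 1 1 (b c) (b e)) =
      cupProduct (show 1 + (1 + 1) = 3 by rfl) z ((2 : ℚ) • θ) := by
  have h1 : ∀ z : bettiCohomology A.X 1, ∑ e, b.coord e z • b e = z := fun z ↦ by
    simp_rw [Module.Basis.coord_apply]; exact b.sum_repr z
  have hE := sum_cup_polarFamily_eq_two_smul A b hℓ
  have : ∀ a c e, (b.coord e (y c) * b.coord a z) • cupProduct (show 1 + (1 + 1) = 3 by rfl) (b a) (BettiUniverse.cup A.X 1 1 (b c) (b e)) =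
      cupProduct (show 1 + (1 + 1) = 3 by rfl) (b.coord a z • b a) (BettiUniverse.cup A.X 1 1 (b c) (b.coord e (y c) • b e)) := by
    intro a c e
    rw [LinearMap.map_smul₂, map_smul, map_smul, smul_smul, mul_comm]
  simp_rw [this, ← map_sum, h1, hE, ← LinearMap.map_sum₂, h1]

/-- `Σ_{a,c,e} b^*_e(y_a) b^*_c(z) · b_a ∪ (b_c ∪ b_e) = −(2θ) ∪ z`. [cite: MumfordAV1970, §16] -/
theorem sum3_coord_polar_ea (z : bettiCohomology A.X 1) :
    ∑ a, ∑ c, ∑ e, (b.coord e (y a) * b.coord c z) • cupProduct (show 1 + (1 + 1) = 3 by rfl) (b a) (BettiUniverse.cup A.X 1 1 (b c) (b e)) =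
      -cupProduct (show 2 + 1 = 3 by rfl) ((2 : ℚ) • θ) z := by
  have h1 : ∀ z : bettiCohomology A.X 1, ∑ e, b.coord e z • b e = z := fun z ↦ by
    simp_rw [Module.Basis.coord_apply]; exact b.sum_repr z
  have hE := sum_cup_polarFamily_eq_two_smul A b hℓ
  have : ∀ a c e, (b.coord e (y a) * b.coord c z) • cupProduct (show 1 + (1 + 1) = 3 by rfl) (b a) (BettiUniverse.cup A.X 1 1 (b c) (b e)) =
      cupProduct (show 1 + (1 + 1) = 3 by rfl) (b a) (BettiUniverse.cup A.X 1 1 (b.coord c z • b c) (b.coord e (y a) • b e)) := by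
    intro a c e
    rw [LinearMap.map_smul₂, map_smul, map_smul, map_smul, smul_smul, mul_comm]
  have hassoc : ∀ a, cupProduct (show 1 + (1 + 1) = 3 by rfl) (b a) (BettiUniverse.cup A.X 1 1 z (y a)) =
      -cupProduct (show 2 + 1 = 3 by rfl) (BettiUniverse.cup A.X 1 1 (b a) (y a)) z := by
    intro a
    rw [BettiUniverse.cup_comm_one z (y a), map_neg,
      ← cupProduct_assoc (rfl : 1 + 1 = 1 + 1) (rfl : 1 + 1 = 1 + 1) (show 1 + 1 + 1 = 3 by rfl) (show 1 + (1 + 1) = 3 by rfl) (b a) (y a) z]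
  simp_rw [this, ← map_sum, h1, ← LinearMap.map_sum₂, h1, hassoc, Finset.sum_neg_distrib, ← LinearMap.map_sum₂, hE]

/-- `Σ_{a,c,e} b^*_e(z) b^*_c(y_a) · b_a ∪ (b_c ∪ b_e) = (2θ) ∪ z`. [cite: MumfordAV1970, §16] -/
theorem sum3_coord_polar_ca (z : bettiCohomology A.X 1) :
    ∑ a, ∑ c, ∑ e, (b.coord e z * b.coord c (y a)) • cupProduct (show 1 + (1 + 1) = 3 by rfl) (b a) (BettiUniverse.cup A.X 1 1 (b c) (b e)) =
      cupProduct (show 2 + 1 = 3 by rfl) ((2 : ℚ) • θ) z := by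
  have h1 : ∀ z : bettiCohomology A.X 1, ∑ e, b.coord e z • b e = z := fun z ↦ by
    simp_rw [Module.Basis.coord_apply]; exact b.sum_repr z
  have hE := sum_cup_polarFamily_eq_two_smul A b hℓ
  have : ∀ a c e, (b.coord e z * b.coord c (y a)) • cupProduct (show 1 + (1 + 1) = 3 by rfl) (b a) (BettiUniverse.cup A.X 1 1 (b c) (b e)) =
      cupProduct (show 1 + (1 + 1) = 3 by rfl) (b a) (BettiUniverse.cup A.X 1 1 (b.coord c (y a) • b c) (b.coord e z • b e)) := by
    intro a c e
    rw [LinearMap.map_smul₂, map_smul, map_smul, map_smul, smul_smul, mul_comm]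
  have hassoc : ∀ a, cupProduct (show 1 + (1 + 1) = 3 by rfl) (b a) (BettiUniverse.cup A.X 1 1 (y a) z) =
      cupProduct (show 2 + 1 = 3 by rfl) (BettiUniverse.cup A.X 1 1 (b a) (y a)) z := by
    intro a
    rw [← cupProduct_assoc (rfl : 1 + 1 = 1 + 1) (rfl : 1 + 1 = 1 + 1) (show 1 + 1 + 1 = 3 by rfl) (show 1 + (1 + 1) = 3 by rfl) (b a) (y a) z]
  simp_rw [this, ← map_sum, h1, ← LinearMap.map_sum₂, h1, hassoc, ← LinearMap.map_sum₂, hE]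

omit hℓ in
/-- `Σ_{a,c,e} b^*_e(z₁) b^*_c(z₂) b^*_a(z₃) · b_a ∪ (b_c ∪ b_e) = z₃ ∪ (z₂ ∪ z₁)`. [folklore] -/
theorem sum3_coord_coord_coord (z₁ z₂ z₃ : bettiCohomology A.X 1) :
    ∑ a, ∑ c, ∑ e, (b.coord e z₁ * b.coord c z₂ * b.coord a z₃) •
        cupProduct (show 1 + (1 + 1) = 3 by rfl) (b a) (BettiUniverse.cup A.X 1 1 (b c) (b e)) =
      cupProduct (show 1 + (1 + 1) = 3 by rfl) z₃ (BettiUniverse.cup A.X 1 1 z₂ z₁) := by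
  have h1 : ∀ z : bettiCohomology A.X 1, ∑ e, b.coord e z • b e = z := fun z ↦ by
    simp_rw [Module.Basis.coord_apply]; exact b.sum_repr z
  have : ∀ a c e, (b.coord e z₁ * b.coord c z₂ * b.coord a z₃) • cupProduct (show 1 + (1 + 1) = 3 by rfl) (b a) (BettiUniverse.cup A.X 1 1 (b c) (b e)) =
      cupProduct (show 1 + (1 + 1) = 3 by rfl) (b.coord a z₃ • b a) (BettiUniverse.cup A.X 1 1 (b.coord c z₂ • b c) (b.coord e z₁ • b e)) := by
    intro a c e
    rw [LinearMap.map_smul₂, LinearMap.map_smul₂, map_smul, map_smul, map_smul, smul_smul, smul_smul]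
    congr 1
    ring
  simp_rw [this, ← map_sum, h1, ← LinearMap.map_sum₂, h1]

/-- The `θ`-part of the traced triple sum: `Σ_{a,c,e} (b^*_e(y_c) b^*_a(z) − b^*_e(y_a) b^*_c(z) + b^*_e(z) b^*_c(y_a)) · b_a ∪ (b_c ∪ b_e)
= 6 · θ ∪ z`. [cite: MumfordAV1970, §16] -/
theorem sum3_thetaPart (z : bettiCohomology A.X 1) :
    ∑ a, ∑ c, ∑ e, (b.coord e (y c) * b.coord a z - b.coord e (y a) * b.coord c z + b.coord e z * b.coord c (y a)) •
        cupProduct (show 1 + (1 + 1) = 3 by rfl) (b a) (BettiUniverse.cup A.X 1 1 (b c) (b e)) =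
      (6 : ℚ) • cupProduct (show 2 + 1 = 3 by rfl) θ z := by
  have hθ3 : cupProduct (show 1 + (1 + 1) = 3 by rfl) z ((2 : ℚ) • θ) = (2 : ℚ) • cupProduct (show 2 + 1 = 3 by rfl) θ z := by
    rw [cupProduct_gradedComm_holds ℚ (ComplexPoints A.X) (show 1 + (1 + 1) = 3 by rfl) (show 2 + 1 = 3 by rfl) z ((2 : ℚ) • θ),
      LinearMap.map_smul₂]
    norm_num
  simp only [sub_smul, add_smul, Finset.sum_add_distrib, Finset.sum_sub_distrib, sum3_coord_polar_ec A b hℓ,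
    sum3_coord_polar_ea A b hℓ, sum3_coord_polar_ca A b hℓ, hθ3, map_smul, LinearMap.smul_apply]
  module

omit hℓ in
/-- The determinant part of the traced triple sum: the alternating sum of the six coordinate triples gives `6 · u ∪ (v ∪ w)`. [folklore] -/
theorem sum3_detPart (u v w : bettiCohomology A.X 1) :
    ∑ a, ∑ c, ∑ e, (b.coord e w * (b.coord c v * b.coord a u - b.coord a v * b.coord c u) -
          b.coord e v * (b.coord c w * b.coord a u - b.coord a w * b.coord c u) +
          b.coord e u * (b.coord c w * b.coord a v - b.coord a w * b.coord c v)) •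
        cupProduct (show 1 + (1 + 1) = 3 by rfl) (b a) (BettiUniverse.cup A.X 1 1 (b c) (b e)) =
      (6 : ℚ) • cupProduct (show 1 + (1 + 1) = 3 by rfl) u (BettiUniverse.cup A.X 1 1 v w) := by
  have expand : ∀ a c e, (b.coord e w * (b.coord c v * b.coord a u - b.coord a v * b.coord c u) -
        b.coord e v * (b.coord c w * b.coord a u - b.coord a w * b.coord c u) +
        b.coord e u * (b.coord c w * b.coord a v - b.coord a w * b.coord c v)) • cupProduct (show 1 + (1 + 1) = 3 by rfl) (b a) (BettiUniverse.cup A.X 1 1 (b c) (b e)) =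
      (b.coord e w * b.coord c v * b.coord a u) • cupProduct (show 1 + (1 + 1) = 3 by rfl) (b a) (BettiUniverse.cup A.X 1 1 (b c) (b e)) -
        (b.coord e w * b.coord c u * b.coord a v) • cupProduct (show 1 + (1 + 1) = 3 by rfl) (b a) (BettiUniverse.cup A.X 1 1 (b c) (b e)) -
        (b.coord e v * b.coord c w * b.coord a u) • cupProduct (show 1 + (1 + 1) = 3 by rfl) (b a) (BettiUniverse.cup A.X 1 1 (b c) (b e)) +
        (b.coord e v * b.coord c u * b.coord a w) • cupProduct (show 1 + (1 + 1) = 3 by rfl) (b a) (BettiUniverse.cup A.X 1 1 (b c) (b e)) +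
        (b.coord e u * b.coord c w * b.coord a v) • cupProduct (show 1 + (1 + 1) = 3 by rfl) (b a) (BettiUniverse.cup A.X 1 1 (b c) (b e)) -
        (b.coord e u * b.coord c v * b.coord a w) • cupProduct (show 1 + (1 + 1) = 3 by rfl) (b a) (BettiUniverse.cup A.X 1 1 (b c) (b e)) := by
    intro a c e
    simp only [← sub_smul, ← add_smul]
    congr 1
    ring
  -- `T z₁ z₂ z₃ = z₁ ∪ (z₂ ∪ z₃)` is alternating
  have hswap12 : ∀ z₁ z₂ z₃ : bettiCohomology A.X 1, cupProduct (show 1 + (1 + 1) = 3 by rfl) z₁ (BettiUniverse.cup A.X 1 1 z₂ z₃) =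
      -cupProduct (show 1 + (1 + 1) = 3 by rfl) z₂ (BettiUniverse.cup A.X 1 1 z₁ z₃) := by
    intro z₁ z₂ z₃
    rw [← cupProduct_assoc (rfl : 1 + 1 = 1 + 1) (rfl : 1 + 1 = 1 + 1) (show 1 + 1 + 1 = 3 by rfl) (show 1 + (1 + 1) = 3 by rfl) z₁ z₂ z₃,
      ← cupProduct_assoc (rfl : 1 + 1 = 1 + 1) (rfl : 1 + 1 = 1 + 1) (show 1 + 1 + 1 = 3 by rfl) (show 1 + (1 + 1) = 3 by rfl) z₂ z₁ z₃,
      show cupProduct (rfl : 1 + 1 = 1 + 1) z₂ z₁ = BettiUniverse.cup A.X 1 1 z₂ z₁ from rfl, BettiUniverse.cup_comm_one z₂ z₁,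
      LinearMap.map_neg₂, neg_neg]
  have hswap23 : ∀ z₁ z₂ z₃ : bettiCohomology A.X 1, cupProduct (show 1 + (1 + 1) = 3 by rfl) z₁ (BettiUniverse.cup A.X 1 1 z₂ z₃) =
      -cupProduct (show 1 + (1 + 1) = 3 by rfl) z₁ (BettiUniverse.cup A.X 1 1 z₃ z₂) := by
    intro z₁ z₂ z₃
    rw [BettiUniverse.cup_comm_one z₃ z₂, map_neg, neg_neg]
  have n1 : cupProduct (show 1 + (1 + 1) = 3 by rfl) v (BettiUniverse.cup A.X 1 1 u w) =
      -cupProduct (show 1 + (1 + 1) = 3 by rfl) u (BettiUniverse.cup A.X 1 1 v w) := hswap12 v u w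
  have n3 : cupProduct (show 1 + (1 + 1) = 3 by rfl) u (BettiUniverse.cup A.X 1 1 w v) =
      -cupProduct (show 1 + (1 + 1) = 3 by rfl) u (BettiUniverse.cup A.X 1 1 v w) := hswap23 u w v
  have n2 : cupProduct (show 1 + (1 + 1) = 3 by rfl) w (BettiUniverse.cup A.X 1 1 u v) =
      cupProduct (show 1 + (1 + 1) = 3 by rfl) u (BettiUniverse.cup A.X 1 1 v w) := by
    rw [hswap12 w u v, hswap23 u w v, neg_neg]
  have n4 : cupProduct (show 1 + (1 + 1) = 3 by rfl) v (BettiUniverse.cup A.X 1 1 w u) =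
      cupProduct (show 1 + (1 + 1) = 3 by rfl) u (BettiUniverse.cup A.X 1 1 v w) := by
    rw [hswap23 v w u, hswap12 v u w, neg_neg]
  have n5 : cupProduct (show 1 + (1 + 1) = 3 by rfl) w (BettiUniverse.cup A.X 1 1 v u) =
      -cupProduct (show 1 + (1 + 1) = 3 by rfl) u (BettiUniverse.cup A.X 1 1 v w) := by
    rw [hswap12 w v u, n4]
  simp_rw [expand]
  simp only [Finset.sum_add_distrib, Finset.sum_sub_distrib, sum3_coord_coord_coord A b]
  rw [n1, n2, n3, n4, n5]
  module


end Sums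

/-! ## The traced triple sum -/

/-- **THE TRACED TRIPLE SUM.** For `k + 3 = dim A`, a basis `b` of `H¹(A(ℂ); ℚ)`, the polar family `y` of `θ` along `b`, every linear
functional `τ` on `H^{2k+6}(A(ℂ); ℚ)` and every `x ∈ H³(A(ℂ); ℚ)`:
`(k+1)(k+2)(k+3) · Σ_a Σ_c Σ_e τ(x ∪ (y_a ∪ (y_c ∪ (y_e ∪ θᵏ)))) · b_a ∪ (b_c ∪ b_e) = (6(k+3)) · θ ∪ ((k+2) · Σ_a τ(x ∪ (y_a ∪ θ^{k+1})) · b_a) − (6 τ(θ^{k+3})) · x`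
— the three-pair matching step (part XXXVIII-g), the two-pair and three-plain formulas at level `k + 1`, the Euler identity; both sides linear in `x`,
checked on `x = u ∪ (v ∪ w)`. [cite: MumfordAV1970, §1 (4) and §16] [cite: Kleiman1968AlgebraicCycles, App. to §2, 2A9–2A11] -/
theorem sum3_smul_cup_eq {n k : ℕ} (hk : k + 3 = A.dim) (b : Module.Basis (Fin n) ℚ (bettiCohomology A.X 1))
    {θ : bettiCohomology A.X 2} {y : Fin n → bettiCohomology A.X 1}
    (hℓ : BettiUniverse.pull μ[A.X] 2 θ - BettiUniverse.pull (fst A.X A.X) 2 θ - BettiUniverse.pull (snd A.X A.X) 2 θ =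
      ∑ a, BettiUniverse.cup (A.X ⊗ A.X) 1 1 (BettiUniverse.pull (fst A.X A.X) 1 (b a))
        (BettiUniverse.pull (snd A.X A.X) 1 (y a)))
    (τ : bettiCohomology A.X (2 * k + 1 + 1 + 1 + 1 + 1 + 1) →ₗ[ℚ] ℚ) (x : bettiCohomology A.X 3) :
    (((k + 1) * (k + 2) * (k + 3) : ℕ) : ℚ) • ∑ a, ∑ c, ∑ e,
        τ (cupProduct (show 3 + (2 * k + 1 + 1 + 1) = 2 * k + 1 + 1 + 1 + 1 + 1 + 1 by omega) x
          (cupProduct (Nat.add_comm 1 (2 * k + 1 + 1)) (y a) (cupProduct (Nat.add_comm 1 (2 * k + 1)) (y c)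
            (cupProduct (show 1 + 2 * k = 2 * k + 1 by omega) (y e) (cupPow ℚ θ k))))) •
          cupProduct (show 1 + (1 + 1) = 3 by rfl) (b a) (BettiUniverse.cup A.X 1 1 (b c) (b e)) =
      (6 * ((k + 3 : ℕ) : ℚ)) • cupProduct (show 2 + 1 = 3 by rfl) θ
          (((k + 2 : ℕ) : ℚ) • ∑ a, τ (cupProduct (show 3 + (2 * k + 1 + 1 + 1) = 2 * k + 1 + 1 + 1 + 1 + 1 + 1 by omega) x
            (cupProduct (Nat.add_comm 1 (2 * k + 1 + 1)) (y a) (cupPow ℚ θ (k + 1)))) • b a) -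
        (6 * τ (cupPow ℚ θ (k + 3))) • x := by
  -- both sides as linear maps in `x`
  set F : bettiCohomology A.X 3 →ₗ[ℚ] bettiCohomology A.X 3 := (((k + 1) * (k + 2) * (k + 3) : ℕ) : ℚ) •
    ∑ a, ∑ c, ∑ e, (τ ∘ₗ (cupProduct (show 3 + (2 * k + 1 + 1 + 1) = 2 * k + 1 + 1 + 1 + 1 + 1 + 1 by omega)).flip
      (cupProduct (Nat.add_comm 1 (2 * k + 1 + 1)) (y a) (cupProduct (Nat.add_comm 1 (2 * k + 1)) (y c)
        (cupProduct (show 1 + 2 * k = 2 * k + 1 by omega) (y e) (cupPow ℚ θ k))))).smulRight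
      (cupProduct (show 1 + (1 + 1) = 3 by rfl) (b a) (BettiUniverse.cup A.X 1 1 (b c) (b e))) with hF
  set G : bettiCohomology A.X 3 →ₗ[ℚ] bettiCohomology A.X 3 :=
    (6 * ((k + 3 : ℕ) : ℚ)) • (cupProduct (show 2 + 1 = 3 by rfl) θ ∘ₗ (((k + 2 : ℕ) : ℚ) •
      ∑ a, (τ ∘ₗ (cupProduct (show 3 + (2 * k + 1 + 1 + 1) = 2 * k + 1 + 1 + 1 + 1 + 1 + 1 by omega)).flip
        (cupProduct (Nat.add_comm 1 (2 * k + 1 + 1)) (y a) (cupPow ℚ θ (k + 1)))).smulRight (b a))) -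
      (τ (cupPow ℚ θ (k + 3)) * 6) • LinearMap.id with hG
  have hFx : ∀ z : bettiCohomology A.X 3, F z = (((k + 1) * (k + 2) * (k + 3) : ℕ) : ℚ) • ∑ a, ∑ c, ∑ e,
      τ (cupProduct (show 3 + (2 * k + 1 + 1 + 1) = 2 * k + 1 + 1 + 1 + 1 + 1 + 1 by omega) z
        (cupProduct (Nat.add_comm 1 (2 * k + 1 + 1)) (y a) (cupProduct (Nat.add_comm 1 (2 * k + 1)) (y c)
          (cupProduct (show 1 + 2 * k = 2 * k + 1 by omega) (y e) (cupPow ℚ θ k))))) •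
        cupProduct (show 1 + (1 + 1) = 3 by rfl) (b a) (BettiUniverse.cup A.X 1 1 (b c) (b e)) := by
    intro z
    simp only [hF, LinearMap.smul_apply, LinearMap.sum_apply, LinearMap.smulRight_apply, LinearMap.comp_apply, LinearMap.flip_apply]
  have hGx : ∀ z : bettiCohomology A.X 3, G z = (6 * ((k + 3 : ℕ) : ℚ)) • cupProduct (show 2 + 1 = 3 by rfl) θ
      (((k + 2 : ℕ) : ℚ) • ∑ a, τ (cupProduct (show 3 + (2 * k + 1 + 1 + 1) = 2 * k + 1 + 1 + 1 + 1 + 1 + 1 by omega) z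
        (cupProduct (Nat.add_comm 1 (2 * k + 1 + 1)) (y a) (cupPow ℚ θ (k + 1)))) • b a) -
      (6 * τ (cupPow ℚ θ (k + 3))) • z := by
    intro z
    simp only [hG, LinearMap.sub_apply, LinearMap.smul_apply, LinearMap.comp_apply, LinearMap.sum_apply, LinearMap.smulRight_apply,
      LinearMap.flip_apply, LinearMap.id_apply, mul_comm _ (6 : ℚ)]
  rw [← hFx, ← hGx]
  refine LinearMap.eqOn_span (R := ℚ) (s := Set.range (cupPowOne ℚ (ComplexPoints A.X) 3)) ?_
    (by rw [span_range_cupPowOne_rat_eq_top A 3]; exact Submodule.mem_top)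
  rintro _ ⟨vv, rfl⟩
  rw [hFx, hGx, cupPowOne_succ, cupPowOne_succ, cupPowOne_one]
  -- `x = u ∪ (v ∪ w)`
  set u := vv 0
  set v := Fin.tail vv 0
  set w := Fin.tail (Fin.tail vv) 0
  have hk1 : ((k + 1 : ℕ) : ℚ) ≠ 0 := by exact_mod_cast Nat.succ_ne_zero k
  have hk2 : ((k + 2 : ℕ) : ℚ) ≠ 0 := by exact_mod_cast Nat.succ_ne_zero (k + 1)
  have hk3 : ((k + 3 : ℕ) : ℚ) ≠ 0 := by exact_mod_cast Nat.succ_ne_zero (k + 2)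
  -- reassociate `(u ∪ (v ∪ w)) ∪ Z = u ∪ (v ∪ (w ∪ Z))` for the two shapes of `Z`
  have hassoc3 : ∀ {m : ℕ} (Z : bettiCohomology A.X (2 * k + 1 + 1 + m + 1)) (h3 : 3 + (2 * k + 1 + 1 + m + 1) = 2 * k + 1 + 1 + m + 1 + 1 + 1 + 1),
      cupProduct h3 (cupProduct (Nat.add_comm 1 (1 + 1)) u (cupProduct (Nat.add_comm 1 1) v w)) Z =
        cupProduct (Nat.add_comm 1 (2 * k + 1 + 1 + m + 1 + 1 + 1)) u (cupProduct (Nat.add_comm 1 (2 * k + 1 + 1 + m + 1 + 1)) v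
          (cupProduct (Nat.add_comm 1 (2 * k + 1 + 1 + m + 1)) w Z)) := by
    intro m Z h3
    rw [cupProduct_assoc (Nat.add_comm 1 (1 + 1)) (show 1 + 1 + (2 * k + 1 + 1 + m + 1) = 2 * k + 1 + 1 + m + 1 + 1 + 1 by omega) h3
        (Nat.add_comm 1 (2 * k + 1 + 1 + m + 1 + 1 + 1)) u (cupProduct (Nat.add_comm 1 1) v w) Z,
      cupProduct_assoc (Nat.add_comm 1 1) (Nat.add_comm 1 (2 * k + 1 + 1 + m + 1))
        (show 1 + 1 + (2 * k + 1 + 1 + m + 1) = 2 * k + 1 + 1 + m + 1 + 1 + 1 by omega) (Nat.add_comm 1 (2 * k + 1 + 1 + m + 1 + 1)) v w Z]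
  have hY : ∀ a c e, cupProduct (show 3 + (2 * k + 1 + 1 + 1) = 2 * k + 1 + 1 + 1 + 1 + 1 + 1 by omega)
      (cupProduct (Nat.add_comm 1 (1 + 1)) u (cupProduct (Nat.add_comm 1 1) v w))
      (cupProduct (Nat.add_comm 1 (2 * k + 1 + 1)) (y a) (cupProduct (Nat.add_comm 1 (2 * k + 1)) (y c)
        (cupProduct (show 1 + 2 * k = 2 * k + 1 by omega) (y e) (cupPow ℚ θ k)))) =
      cupProduct (Nat.add_comm 1 (2 * k + 1 + 1 + 1 + 1 + 1)) u (cupProduct (Nat.add_comm 1 (2 * k + 1 + 1 + 1 + 1)) v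
        (cupProduct (Nat.add_comm 1 (2 * k + 1 + 1 + 1)) w (cupProduct (Nat.add_comm 1 (2 * k + 1 + 1)) (y a)
          (cupProduct (Nat.add_comm 1 (2 * k + 1)) (y c) (cupProduct (show 1 + 2 * k = 2 * k + 1 by omega) (y e) (cupPow ℚ θ k)))))) :=
    fun a c e ↦ hassoc3 (m := 0) _ _
  have hY1 : ∀ a, cupProduct (show 3 + (2 * k + 1 + 1 + 1) = 2 * k + 1 + 1 + 1 + 1 + 1 + 1 by omega)
      (cupProduct (Nat.add_comm 1 (1 + 1)) u (cupProduct (Nat.add_comm 1 1) v w))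
      (cupProduct (Nat.add_comm 1 (2 * k + 1 + 1)) (y a) (cupPow ℚ θ (k + 1))) =
      cupProduct (Nat.add_comm 1 (2 * k + 1 + 1 + 1 + 1 + 1)) u (cupProduct (Nat.add_comm 1 (2 * k + 1 + 1 + 1 + 1)) v
        (cupProduct (Nat.add_comm 1 (2 * k + 1 + 1 + 1)) w (cupProduct (Nat.add_comm 1 (2 * k + 1 + 1)) (y a) (cupPow ℚ θ (k + 1))))) :=
    fun a ↦ hassoc3 (m := 0) _ _
  -- abbreviations for the trace forms `P z z' = τ(z ∪ (z' ∪ θ^{k+2}))` and `Q = τ(θ^{k+3})`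
  set P : bettiCohomology A.X 1 → bettiCohomology A.X 1 → ℚ := fun z z' ↦
    τ (cupProduct (Nat.add_comm 1 (2 * k + 1 + 1 + 1 + 1 + 1)) z (cupProduct (Nat.add_comm 1 (2 * k + 1 + 1 + 1 + 1)) z' (cupPow ℚ θ (k + 2))))
    with hP
  set Q : ℚ := τ (cupPow ℚ θ (k + 3)) with hQ
  -- the matching step and the level-(k+1) formulas, under `τ` and cleared of denominators
  have key : ∀ a c e, (((k + 1) * (k + 2) * (k + 3) : ℕ) : ℚ) *
      τ (cupProduct (Nat.add_comm 1 (2 * k + 1 + 1 + 1 + 1 + 1)) u (cupProduct (Nat.add_comm 1 (2 * k + 1 + 1 + 1 + 1)) v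
        (cupProduct (Nat.add_comm 1 (2 * k + 1 + 1 + 1)) w (cupProduct (Nat.add_comm 1 (2 * k + 1 + 1)) (y a)
          (cupProduct (Nat.add_comm 1 (2 * k + 1)) (y c) (cupProduct (show 1 + 2 * k = 2 * k + 1 by omega) (y e) (cupPow ℚ θ k))))))) =
      ((k + 3 : ℕ) : ℚ) * (b.coord e (y c) * (b.coord a w * P u v - b.coord a v * P u w + b.coord a u * P v w)) -
      ((k + 3 : ℕ) : ℚ) * (b.coord e (y a) * (b.coord c w * P u v - b.coord c v * P u w + b.coord c u * P v w)) +
      (((k + 3 : ℕ) : ℚ) * (b.coord e w * (b.coord c (y a) * P u v)) - b.coord e w * (b.coord c v * b.coord a u - b.coord a v * b.coord c u) * Q) -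
      (((k + 3 : ℕ) : ℚ) * (b.coord e v * (b.coord c (y a) * P u w)) - b.coord e v * (b.coord c w * b.coord a u - b.coord a w * b.coord c u) * Q) +
      (((k + 3 : ℕ) : ℚ) * (b.coord e u * (b.coord c (y a) * P v w)) - b.coord e u * (b.coord c w * b.coord a v - b.coord a w * b.coord c v) * Q) := by
    intro a c e
    have hm := congrArg τ (smul_cup6_polar3_cupPow A hk b hℓ a c e u v w)
    have t1 := congrArg τ (smul_cup_cup_cup_polar_cupPow' A hk b hℓ a u v w)
    have t2 := congrArg τ (smul_cup_cup_cup_polar_cupPow' A hk b hℓ c u v w)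
    have t3 := congrArg τ (smul_cup_cup_polar_polar_cupPow' A hk b hℓ a c u v)
    have t4 := congrArg τ (smul_cup_cup_polar_polar_cupPow' A hk b hℓ a c u w)
    have t5 := congrArg τ (smul_cup_cup_polar_polar_cupPow' A hk b hℓ a c v w)
    simp only [map_smul, map_sub, map_add, smul_eq_mul] at hm t1 t2 t3 t4 t5
    rw [Nat.cast_mul, Nat.cast_mul]
    linear_combination (((k + 2 : ℕ) : ℚ) * ((k + 3 : ℕ) : ℚ)) * hm + (((k + 3 : ℕ) : ℚ) * b.coord e (y c)) * t1 -
      (((k + 3 : ℕ) : ℚ) * b.coord e (y a)) * t2 + b.coord e w * t3 - b.coord e v * t4 + b.coord e u * t5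
  -- the inner sum of the right-hand side: `(k+2) Σ_a τ(u v w y_a θ^{k+1}) b_a = P u v • w − P u w • v + P v w • u`
  have h1 : ∀ z : bettiCohomology A.X 1, ∑ e, b.coord e z • b e = z := fun z ↦ by
    simp_rw [Module.Basis.coord_apply]; exact b.sum_repr z
  have hinner : ((k + 2 : ℕ) : ℚ) • ∑ a, τ (cupProduct (Nat.add_comm 1 (2 * k + 1 + 1 + 1 + 1 + 1)) u (cupProduct (Nat.add_comm 1 (2 * k + 1 + 1 + 1 + 1)) v
      (cupProduct (Nat.add_comm 1 (2 * k + 1 + 1 + 1)) w (cupProduct (Nat.add_comm 1 (2 * k + 1 + 1)) (y a) (cupPow ℚ θ (k + 1)))))) • b a =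
      P u v • w - P u w • v + P v w • u := by
    have : ∀ a, ((k + 2 : ℕ) : ℚ) • (τ (cupProduct (Nat.add_comm 1 (2 * k + 1 + 1 + 1 + 1 + 1)) u (cupProduct (Nat.add_comm 1 (2 * k + 1 + 1 + 1 + 1)) v
        (cupProduct (Nat.add_comm 1 (2 * k + 1 + 1 + 1)) w (cupProduct (Nat.add_comm 1 (2 * k + 1 + 1)) (y a) (cupPow ℚ θ (k + 1)))))) • b a) =
        (P u v * b.coord a w) • b a - (P u w * b.coord a v) • b a + (P v w * b.coord a u) • b a := by
      intro a
      have t1 := congrArg τ (smul_cup_cup_cup_polar_cupPow' A hk b hℓ a u v w)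
      simp only [map_smul, map_sub, map_add, smul_eq_mul] at t1
      rw [smul_smul, t1, ← sub_smul, ← add_smul]
      congr 1
      ring
    rw [Finset.smul_sum, Finset.sum_congr rfl fun a _ ↦ this a, Finset.sum_add_distrib, Finset.sum_sub_distrib]
    simp_rw [mul_smul, ← Finset.smul_sum, h1]
  -- assemble
  simp_rw [hY, hY1]
  rw [hinner]
  simp_rw [Finset.smul_sum, smul_smul, key]
  -- split each summand into its `θ`-part and its determinant part
  have expand : ∀ a c e,
      (((k + 3 : ℕ) : ℚ) * (b.coord e (y c) * (b.coord a w * P u v - b.coord a v * P u w + b.coord a u * P v w)) -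
        ((k + 3 : ℕ) : ℚ) * (b.coord e (y a) * (b.coord c w * P u v - b.coord c v * P u w + b.coord c u * P v w)) +
        (((k + 3 : ℕ) : ℚ) * (b.coord e w * (b.coord c (y a) * P u v)) - b.coord e w * (b.coord c v * b.coord a u - b.coord a v * b.coord c u) * Q) -
        (((k + 3 : ℕ) : ℚ) * (b.coord e v * (b.coord c (y a) * P u w)) - b.coord e v * (b.coord c w * b.coord a u - b.coord a w * b.coord c u) * Q) +
        (((k + 3 : ℕ) : ℚ) * (b.coord e u * (b.coord c (y a) * P v w)) - b.coord e u * (b.coord c w * b.coord a v - b.coord a w * b.coord c v) * Q)) •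
        cupProduct (show 1 + (1 + 1) = 3 by rfl) (b a) (BettiUniverse.cup A.X 1 1 (b c) (b e)) =
      (((k + 3 : ℕ) : ℚ) * P u v) • ((b.coord e (y c) * b.coord a w - b.coord e (y a) * b.coord c w + b.coord e w * b.coord c (y a)) • cupProduct (show 1 + (1 + 1) = 3 by rfl) (b a) (BettiUniverse.cup A.X 1 1 (b c) (b e))) -
      (((k + 3 : ℕ) : ℚ) * P u w) • ((b.coord e (y c) * b.coord a v - b.coord e (y a) * b.coord c v + b.coord e v * b.coord c (y a)) • cupProduct (show 1 + (1 + 1) = 3 by rfl) (b a) (BettiUniverse.cup A.X 1 1 (b c) (b e))) +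
      (((k + 3 : ℕ) : ℚ) * P v w) • ((b.coord e (y c) * b.coord a u - b.coord e (y a) * b.coord c u + b.coord e u * b.coord c (y a)) • cupProduct (show 1 + (1 + 1) = 3 by rfl) (b a) (BettiUniverse.cup A.X 1 1 (b c) (b e))) -
      Q • ((b.coord e w * (b.coord c v * b.coord a u - b.coord a v * b.coord c u) -
          b.coord e v * (b.coord c w * b.coord a u - b.coord a w * b.coord c u) +
          b.coord e u * (b.coord c w * b.coord a v - b.coord a w * b.coord c v)) • cupProduct (show 1 + (1 + 1) = 3 by rfl) (b a) (BettiUniverse.cup A.X 1 1 (b c) (b e))) := by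
    intro a c e
    simp only [smul_smul, ← sub_smul, ← add_smul]
    congr 1
    ring
  simp_rw [expand]
  simp only [Finset.sum_add_distrib, Finset.sum_sub_distrib]
  simp only [← Finset.smul_sum]
  rw [sum3_thetaPart A b hℓ w, sum3_thetaPart A b hℓ v, sum3_thetaPart A b hℓ u, sum3_detPart A b u v w,
    show cupProduct (Nat.add_comm 1 (1 + 1)) u (cupProduct (Nat.add_comm 1 1) v w) =
      cupProduct (show 1 + (1 + 1) = 3 by rfl) u (BettiUniverse.cup A.X 1 1 v w) from rfl]
  simp only [map_sub, map_add, map_smul, smul_sub, smul_add, smul_smul]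
  module

end Summit.HodgeConjecture.HodgeConjecture.Ring2.AbelianAll

end
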